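import Literature.Probability.Moments.ConnectedCorrelations
import Literature.InformationTheory.Entanglement.TwoCopySwapPurity
import HarnessLib

/-!
# Collective-spin variance (pure-state quantum Fisher information): the separable bound,
# the `k`-producible bound, the `N²` ceiling and the 2-design ("Haar random") mean

pub-qadeq lane (HONEST FRAMING: instance-level adjudication of specific advantage claims; no claim
about BQP vs BPP or the summit), CLAIMS row E-58: K. Nagao, T. Shirakawa, R. Sun, P. Prelovšek,
S. Yunoki, *Probing many-body localization crossover in quasiperiodic Floquet circuits on a quantum
processor*, arXiv:2603.12675 (2026) [NagaoEtAl2026], held text `paper:arxiv-2603.12675` p0004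
L101–116:

> "we evaluate a quantum Fisher information (QFI) for the fully polarized initial state [55, 56],
> defined as the sum of all-to-all correlation functions of Pauli-Z operators
> `F_Q = 4 Σ_{i,j} (⟨Ẑ_iẐ_j⟩ − ⟨Ẑ_i⟩⟨Ẑ_j⟩)` (9). This quantity serves as an entanglement witness
> that captures deviations from an unentangled state. The QFI in the form of Eq. (9) can be readily
> reconstructed from measured bitstring samples obtained in shots"; Fig. 4: "the QFI rapidly
> approaches the Haar random value `F_Q^Haar` … signaling thermalization to an infinite-temperature
> state described by Haar-random states".

The source of the underlying statements is the review G. Tóth, I. Apellaniz, *Quantum metrology from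
a quantum information science perspective*, J. Phys. A 47, 424006 (2014) = arXiv:1405.4878
[TothApellaniz2014] (held text `paper:arxiv-1405.4878`), with `J_l := Σ_n j_l^{(n)}`,
`j_l^{(n)} = ½σ_l^{(n)}` (p0004) — so eq. (9) (`Σ Ẑ_i = 2J_z`) is `4×` the review's `F_Q`:

> (p0010) "(i) For pure states … `F_Q[ϱ, A] = 4(ΔA)²`. (ii) For all quantum states …
> `F_Q[ϱ, A] ≤ 4(ΔA)²`" (the variance is concave, p0011);
> (p0014) "for pure product states we can write `F_Q[ϱ, J_l] = 4(ΔJ_l)² = 4Σ_n (Δj_l^{(n)})² ≤ N` …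
> we used the fact that for a product state the variance of a collective observable is the sum of
> the single-particle variances. Due to the convexity of the quantum Fisher information, this upper
> bound is also valid for separable states … `F_Q[ϱ, J_l] ≤ N` [Pezzè–Smerzi, PRL 102, 100401].
> All states violating [it] are entangled. … For pure states, we have `F_Q[ϱ, J_l] = 4(ΔJ_l)² ≤ N²`,
> which is a valid bound again for mixed states";
> (p0015) "For `N`-qubit `k`-producible states … `F_Q[ϱ, J_l] ≤ sk² + (N − sk)²` … for the case `N`
> divisible by `k` … `F_Q = Nk`."

## What is formalised (everything proved; no named facts)

Since eq. (9) involves only COMMUTING (`Z`-diagonal) observables, its value in any state is a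
functional of the `Z`-basis outcome distribution `W` (Born weights; `star_dotProduct_diagonal_mulVec`),
and a PURE PRODUCT state `⊗_b |φ_b⟩` has the PRODUCT Born weight `∏_b |φ_b(ω_b)|²`
(`normSq_prod_eq_prodWeight`). Accordingly the statements are proved for weights on finite product
sample spaces (the tree's `Literature.Probability.Moments.moment_prod_indep` supplies independence):

* `expval`, `qfiZ W Z` = eq. (9) for a weight `W` and observables `Z_b`; `qfiZ_eq_four_mul_variance`:
  `F = 4(⟨J²⟩ − ⟨J⟩²)`, `J = Σ_b Z_b` (TA (i) with the variance identity of p0005);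
* `qfiZ_le_four_mul_sq`: `|J| ≤ M` pointwise ⇒ `F ≤ 4M²` (TA `F_Q ≤ N²`, i.e. `F ≤ 4N²` here);
* `qfiZ_prodWeight`: for a product weight over blocks and block-local observables,
  `F = 4 Σ_b Var_b` — "the variance of a collective observable is the sum of the single-particle
  variances"; `qfiZ_prodWeight_le_sum_sq`: `|Z_b| ≤ N_b ⇒ F ≤ 4 Σ_b N_b²` (the pure `k`-producible
  form); `qfiZ_prodWeight_le_of_blocks_le`: `N_b ≤ k ⇒ F ≤ 4kN` (TA "`F_Q = Nk`", valid for all `N`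
  since `sk² + (N − sk)² ≤ kN`; the sharper `sk² + (N − sk)²` maximisation is NOT formalised);
* **`qfiZ_prodWeight_le_four_mul_card`**: single-site blocks, `|Z_i| ≤ 1` ⇒ `F ≤ 4N` — the
  Pezzè–Smerzi separable bound in the normalisation of eq. (9), for pure product states;
* **`qfiZ_twoPoint`**: the caveat the review states as (ii) — for the classical two-point mixture
  (`Z`-statistics of the SEPARABLE mixed state `½(|0…0⟩⟨0…0| + |1…1⟩⟨1…1|)`) eq. (9) equals
  `4N²`; eq. (9) is the QFI only of a pure state, and exceeds `4N` without entanglement once the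
  state is mixed;
* the 2-design ("Haar random") mean, from the tree's `IsStateTwoDesign` (Zhu–Kueng–Grassl–Gross
  Prop. 1, `(1/K)Σ(|ψ⟩⟨ψ|)^{⊗2} = (𝟙+F)/(N(N+1))`) and swap trick `Tr(F(A⊗B)) = Tr(AB)`
  (`TwoCopy.trace_swapOp_mul_kronecker`): `twoDesign_avg_expect_mul_expect`
  (`𝔼⟨A⟩⟨B⟩ = (TrA TrB + TrAB)/(N(N+1))`), `twoDesign_avg_expect` (`𝔼⟨A⟩ = TrA/N`),
  `twoDesign_avg_qfi` (`𝔼 4(⟨A²⟩ − ⟨A⟩²) = 4[TrA²/N − (TrA² + (TrA)²)/(N(N+1))]`),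
  `twoDesign_avg_qfi_of_trace_zero` (`= 4cN/(N+1)` when `TrA = 0`, `TrA² = cN`);
* the collective spin `collectiveZ κ = Σ_i Ẑ_i` on `n = |κ|` qubits: `trace_collectiveZ` (`= 0`),
  `trace_collectiveZ_sq` (`= n·2ⁿ`), hence **`twoDesign_avg_qfi_collectiveZ`**: the design mean of
  eq. (9) in a pure state is `F^Haar = 4n·2ⁿ/(2ⁿ+1)`, and `haarValue_lt_separable_bound`:
  `4n·2ⁿ/(2ⁿ+1) < 4n` — the "Haar random value" that E-58's data approach lies strictly below the
  separable bound, so eq. (9) ≤ `F^Haar` never certifies entanglement (a typing remark for the row,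
  numbers not adjectives: separable bound `4N`, Haar mean `4N·2^N/(2^N+1)`, ceiling `4N²`).

Not formalised: the mixed-state quantum Fisher information (symmetric logarithmic derivative) and
its convexity — hence the separable MIXED-state bound is not claimed here beyond the pure/product
case and the explicit counterexample for eq. (9); Haar measure itself (2-designs stand in for it,
exactly for second moments).  (The `sk² + (N−sk)²` optimisation IS formalised, appended section
`KProducible`: `sum_sq_le_of_blocks_le`, `qfiZ_prodWeight_le_kProducible`.)

## References

* [NagaoEtAl2026] K. Nagao et al., arXiv:2603.12675 (2026), eq. (9), Fig. 4 (held text p0004, p0006).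
* [TothApellaniz2014] G. Tóth, I. Apellaniz, J. Phys. A 47 (2014) 424006 = arXiv:1405.4878, §2
  (p0004–p0005), §4.1 (i)–(ii) (p0010–p0011), §5.2 eqs. "fqbound"/"F2eb"/"He" (p0014), §5.3
  (p0015).
* [PezzeSmerzi2009] L. Pezzè, A. Smerzi, PRL 102, 100401 (2009) (the separable bound, as cited by
  the review).
* [ZhuEtAl2016] H. Zhu, R. Kueng, M. Grassl, D. Gross, arXiv:1609.08172, §2 Prop. 1 (through
  `Literature.Computability.QuantumComplexity.DesignAnticoncentration.IsStateTwoDesign`).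
* [EkertEtAl2002] A. Ekert et al., PRL 88, 217901 (2002), eq. (2) (through
  `Literature.InformationTheory.Entanglement.TwoCopy.trace_swapOp_mul_kronecker`).
-/

noncomputable section

open Finset Matrix
open scoped Kronecker

namespace Literature.InformationTheory.Entanglement

namespace CollectiveVariance

open Literature.Probability.Moments

/-! ### The measured quantity: `F = 4 Σ_{b,c} (⟨Z_b Z_c⟩ − ⟨Z_b⟩⟨Z_c⟩)` -/

section General

variable {Ω : Type*} [Fintype Ω] {β : Type*} [Fintype β]

/-- Expectation `⟨f⟩_W = Σ_ω W(ω) f(ω)` under weights `W` on a finite sample space (Born or empirical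
weights of Z-basis bit strings). [cite: NagaoEtAl2026, eq. (9) (the correlators `⟨Ẑ_iẐ_j⟩`, `⟨Ẑ_i⟩`
"reconstructed from measured bitstring samples")] -/
def expval (W : Ω → ℝ) (f : Ω → ℝ) : ℝ := ∑ ω, W ω * f ω

/-- **The collective-`Z` "quantum Fisher information" of NagaoEtAl2026 eq. (9)**:
`F_Q = 4 Σ_{i,j} (⟨Ẑ_i Ẑ_j⟩ − ⟨Ẑ_i⟩⟨Ẑ_j⟩)` for commuting (Z-diagonal) observables `Z_b` read off
the same bit strings. [cite: NagaoEtAl2026, eq. (9)] -/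
def qfiZ (W : Ω → ℝ) (Z : β → Ω → ℝ) : ℝ :=
  4 * ∑ b, ∑ c, (expval W (fun ω => Z b ω * Z c ω) - expval W (Z b) * expval W (Z c))

omit [Fintype β] in
/-- `expval` is linear in the observable: sums. [folklore] -/
private theorem expval_sum (W : Ω → ℝ) (s : Finset β) (f : β → Ω → ℝ) :
    expval W (fun ω => ∑ b ∈ s, f b ω) = ∑ b ∈ s, expval W (f b) := by
  unfold expval
  rw [Finset.sum_comm]
  refine Finset.sum_congr rfl fun ω _ => ?_
  rw [Finset.mul_sum]

/-- **`F_Q` is four times the variance of the collective observable** `J = Σ_b Z_b`: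
`F = 4 (⟨J²⟩ − ⟨J⟩²)` — the identity `(ΔJ)² + ⟨J⟩² = ⟨J²⟩` applied to eq. (9); for a PURE state
measured in its `Z` basis this is the quantum Fisher information `F_Q[ψ, J] = 4 (ΔJ)²`.
[cite: TothApellaniz2014, eq. `F_Q[ϱ, A] = 4(ΔA)²` for pure states (held text p0010) and
`(ΔJ_l)² + ⟨J_l⟩² = ⟨J_l²⟩` (p0005)] [cite: NagaoEtAl2026, eq. (9)] -/
theorem qfiZ_eq_four_mul_variance (W : Ω → ℝ) (Z : β → Ω → ℝ) :
    qfiZ W Z = 4 * (expval W (fun ω => (∑ b, Z b ω) ^ 2) - (expval W (fun ω => ∑ b, Z b ω)) ^ 2) := by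
  unfold qfiZ
  congr 1
  rw [Finset.sum_comm.trans (Finset.sum_comm), expval_sum W univ]
  have h1 : expval W (fun ω => (∑ b, Z b ω) ^ 2) =
      ∑ b, ∑ c, expval W (fun ω => Z b ω * Z c ω) := by
    have : (fun ω => (∑ b, Z b ω) ^ 2) = fun ω => ∑ b, ∑ c, Z b ω * Z c ω := by
      funext ω; rw [sq, Finset.sum_mul_sum]
    rw [this, expval_sum]
    exact Finset.sum_congr rfl fun b _ => expval_sum W univ _
  rw [h1, sq, Finset.sum_mul_sum, ← Finset.sum_sub_distrib]
  exact Finset.sum_congr rfl fun b _ => by rw [← Finset.sum_sub_distrib]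

/-- **The trivial ceiling** `F ≤ 4 M²` when `|J| ≤ M` pointwise and `W` is a probability weight —
with `N` spin-½ sites (`|J| ≤ N`) this is `F_Q = 4(ΔJ_l)² ≤ N²` of the review in the normalisation of
eq. (9) (`J = Σ Ẑ_i` instead of `½ Σ σ`): `F ≤ 4N²`, "a valid bound again for mixed states".
[cite: TothApellaniz2014, eq. `F_Q[ϱ, J_l] = 4(ΔJ_l)² ≤ N²` (held text p0014)] -/
theorem qfiZ_le_four_mul_sq (W : Ω → ℝ) (hW : ∀ ω, 0 ≤ W ω) (hW1 : ∑ ω, W ω = 1)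
    (Z : β → Ω → ℝ) {M : ℝ} (hM : ∀ ω, |∑ b, Z b ω| ≤ M) :
    qfiZ W Z ≤ 4 * M ^ 2 := by
  rw [qfiZ_eq_four_mul_variance]
  have h1 : expval W (fun ω => (∑ b, Z b ω) ^ 2) ≤ M ^ 2 := by
    unfold expval
    calc ∑ ω, W ω * (∑ b, Z b ω) ^ 2 ≤ ∑ ω, W ω * M ^ 2 :=
          Finset.sum_le_sum fun ω _ => mul_le_mul_of_nonneg_left (sq_le_sq' (abs_le.mp (hM ω)).1
            (abs_le.mp (hM ω)).2) (hW ω)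
      _ = M ^ 2 := by rw [← Finset.sum_mul, hW1, one_mul]
  nlinarith [sq_nonneg (expval W (fun ω => ∑ b, Z b ω))]

end General

/-! ### Product (block-product) states: variances add, `F ≤ 4 Σ_b N_b²` -/

section Product

variable {β : Type*} [Fintype β] [DecidableEq β] {Ω : β → Type*} [∀ b, Fintype (Ω b)]

/-- The product weight `W(ω) = ∏_b p_b(ω_b)` of a product state over blocks `b` (for a pure
`k`-producible state `⊗_b |ψ_b⟩` measured in the `Z` basis: `p_b = |ψ_b|²`).
[cite: TothApellaniz2014, §3.2 (`k`-producible pure states `|Ψ⟩ = ⊗_l |Ψ_l⟩`, held text p0008)] -/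
def prodWeight (p : ∀ b, Ω b → ℝ) : (∀ b, Ω b) → ℝ := fun ω => ∏ b, p b (ω b)

/-- Single-block expectation `⟨g⟩_b = Σ_x p_b(x) g(x)`. [folklore] -/
def blockExpect (p : ∀ b, Ω b → ℝ) (b : β) (g : Ω b → ℝ) : ℝ := ∑ x, p b x * g x

/-- Under a product weight with unit block masses, a block-local observable has the block
expectation: `⟨f_b(ω_b)⟩_W = ⟨f_b⟩_b`. [cite: TothApellaniz2014, eq. `4(ΔJ_l)² = 4 Σ_n (Δj_l^{(n)})²`
("for a product state the variance of a collective observable is the sum of the single-particle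
variances", held text p0014)] -/
theorem expval_prodWeight_local (p : ∀ b, Ω b → ℝ) (hp : ∀ b, ∑ x, p b x = 1)
    (f : ∀ b, Ω b → ℝ) (b : β) :
    expval (prodWeight p) (fun ω => f b (ω b)) = blockExpect p b (f b) := by
  have h := moment_prod_indep p hp f {b}
  rw [Finset.prod_singleton] at h
  unfold blockExpect
  rw [← h]
  unfold expval moment prodWeight
  exact Finset.sum_congr rfl fun ω _ => by rw [Finset.prod_singleton]

/-- … and two DIFFERENT blocks are uncorrelated: `⟨f_b(ω_b) f_c(ω_c)⟩_W = ⟨f_b⟩_b ⟨f_c⟩_c` for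
`b ≠ c`. [cite: TothApellaniz2014, eq. `4(ΔJ_l)² = 4 Σ_n (Δj_l^{(n)})²` (held text p0014)] -/
theorem expval_prodWeight_mul_of_ne (p : ∀ b, Ω b → ℝ) (hp : ∀ b, ∑ x, p b x = 1)
    (f : ∀ b, Ω b → ℝ) {b c : β} (hbc : b ≠ c) :
    expval (prodWeight p) (fun ω => f b (ω b) * f c (ω c)) =
      blockExpect p b (f b) * blockExpect p c (f c) := by
  have h := moment_prod_indep p hp f {b, c}
  rw [Finset.prod_pair hbc] at h
  unfold blockExpect
  rw [← h]
  unfold expval moment prodWeight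
  exact Finset.sum_congr rfl fun ω _ => by rw [Finset.prod_pair hbc]

/-- **Variances add over independent blocks**: for a product weight and block-local observables
`Z_b(ω) = f_b(ω_b)`, `F = 4 Σ_b (⟨f_b²⟩_b − ⟨f_b⟩_b²)`.
[cite: TothApellaniz2014, eq. `F_Q[ϱ, J_l] = 4(ΔJ_l)² = 4 Σ_n (Δj_l^{(n)})²` for pure product states
(held text p0014)] -/
theorem qfiZ_prodWeight (p : ∀ b, Ω b → ℝ) (hp : ∀ b, ∑ x, p b x = 1) (f : ∀ b, Ω b → ℝ) :
    qfiZ (prodWeight p) (fun b ω => f b (ω b)) =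
      4 * ∑ b, (blockExpect p b (fun x => f b x ^ 2) - (blockExpect p b (f b)) ^ 2) := by
  unfold qfiZ
  congr 1
  refine Finset.sum_congr rfl fun b _ => ?_
  rw [← Finset.sum_erase_add _ _ (Finset.mem_univ b)]
  have h0 : ∑ c ∈ univ.erase b, (expval (prodWeight p) (fun ω => f b (ω b) * f c (ω c)) -
      expval (prodWeight p) (fun ω => f b (ω b)) * expval (prodWeight p) (fun ω => f c (ω c))) = 0 := by
    refine Finset.sum_eq_zero fun c hc => ?_
    rw [expval_prodWeight_mul_of_ne p hp f (Finset.ne_of_mem_erase hc).symm,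
      expval_prodWeight_local p hp f b, expval_prodWeight_local p hp f c, sub_self]
  rw [h0, zero_add, expval_prodWeight_local p hp f b, sq]
  congr 1
  have h := expval_prodWeight_local p hp (fun c x => f c x ^ 2) b
  simp only [sq] at h ⊢
  exact h

/-- **The `k`-producible (block) bound**: if moreover every block weight is non-negative and the
block observable is bounded, `|f_b| ≤ N_b` (a block of `N_b` spins-½ contributes `Σ_{i∈b} Ẑ_i`), then
`F ≤ 4 Σ_b N_b²` — the pure-state form of the bound for `k`-producible states (Hyllus et al.,
Tóth 2012), whose maximisation over block sizes `N_b ≤ k`, `Σ N_b = N` is the printed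
`sk² + (N − sk)²`. [cite: TothApellaniz2014, eq. `F_Q[ϱ, J_l] ≤ sk² + (N − sk)²` for `N`-qubit
`k`-producible states (held text p0015)] -/
theorem qfiZ_prodWeight_le_sum_sq (p : ∀ b, Ω b → ℝ) (hp0 : ∀ b x, 0 ≤ p b x)
    (hp : ∀ b, ∑ x, p b x = 1) (f : ∀ b, Ω b → ℝ) (Nb : β → ℝ)
    (hf : ∀ b x, |f b x| ≤ Nb b) :
    qfiZ (prodWeight p) (fun b ω => f b (ω b)) ≤ 4 * ∑ b, Nb b ^ 2 := by
  rw [qfiZ_prodWeight p hp f]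
  refine mul_le_mul_of_nonneg_left (Finset.sum_le_sum fun b _ => ?_) (by norm_num)
  have h1 : blockExpect p b (fun x => f b x ^ 2) ≤ Nb b ^ 2 := by
    unfold blockExpect
    calc ∑ x, p b x * f b x ^ 2 ≤ ∑ x, p b x * Nb b ^ 2 :=
          Finset.sum_le_sum fun x _ => mul_le_mul_of_nonneg_left
            (sq_le_sq' (abs_le.mp (hf b x)).1 (abs_le.mp (hf b x)).2) (hp0 b x)
      _ = Nb b ^ 2 := by rw [← Finset.sum_mul, hp b, one_mul]
  nlinarith [sq_nonneg (blockExpect p b (f b))]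

/-- **`F ≤ 4 k N` for blocks of at most `k` spins** (`N_b ≤ k`, `Σ_b N_b = N`): the form
"for `N` divisible by `k`, `F_Q ≤ Nk`" of the review, valid for every `N` since
`sk² + (N − sk)² ≤ kN`. [cite: TothApellaniz2014, eq. `F_Q[ϱ, J_n⃗] = Nk` (the `k`-producible bound
for `k ∣ N`, held text p0015)] -/
theorem qfiZ_prodWeight_le_of_blocks_le (p : ∀ b, Ω b → ℝ) (hp0 : ∀ b x, 0 ≤ p b x)
    (hp : ∀ b, ∑ x, p b x = 1) (f : ∀ b, Ω b → ℝ) (Nb : β → ℝ) (hf : ∀ b x, |f b x| ≤ Nb b)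
    {k : ℝ} (hk : ∀ b, Nb b ≤ k) :
    qfiZ (prodWeight p) (fun b ω => f b (ω b)) ≤ 4 * (k * ∑ b, Nb b) := by
  refine (qfiZ_prodWeight_le_sum_sq p hp0 hp f Nb hf).trans ?_
  refine mul_le_mul_of_nonneg_left ?_ (by norm_num)
  rw [Finset.mul_sum]
  refine Finset.sum_le_sum fun b _ => ?_
  obtain ⟨x, -⟩ := Finset.nonempty_of_sum_ne_zero (by rw [hp b]; exact one_ne_zero)
  have h0 : 0 ≤ Nb b := (abs_nonneg _).trans (hf b x)
  rw [sq]
  exact mul_le_mul_of_nonneg_right (hk b) h0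

end Product

/-! ### Spins-½: the separable bound `F ≤ 4N`, and why purity matters -/

section Spins

variable {β : Type*} [Fintype β] [DecidableEq β] {Ω : β → Type*} [∀ b, Fintype (Ω b)]

/-- **The separable (fully product) bound, Pezzè–Smerzi**: for a product weight over the `N` sites
and `±1`-bounded site observables (`Ẑ_i = ±1`), `F ≤ 4N` — the review's
`F_Q[ϱ, J_l] = 4(ΔJ_l)² = 4Σ_n(Δj_l^{(n)})² ≤ N` for pure product states in the normalisation of
eq. (9) (`Σ Ẑ_i = 2J_z`, so `F = 4·F_Q^{review}`). The extension to separable MIXED states is by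
convexity of the quantum Fisher information and is NOT the statement that eq. (9) stays `≤ 4N` for
mixed states (see `qfiZ_twoPoint`). [cite: TothApellaniz2014, eqs. `F_Q[ϱ,J_l] = 4(ΔJ_l)² =
4Σ_n (Δj_l^{(n)})² ≤ N` and `F_Q[ϱ, J_l] ≤ N` for separable states (held text p0014)]
[cite: PezzeSmerzi2009, the criterion `F_Q > N ⇒ entangled` (as eq. F2eb of TothApellaniz2014)] -/
theorem qfiZ_prodWeight_le_four_mul_card (p : ∀ b, Ω b → ℝ) (hp0 : ∀ b x, 0 ≤ p b x)
    (hp : ∀ b, ∑ x, p b x = 1) (f : ∀ b, Ω b → ℝ) (hf : ∀ b x, |f b x| ≤ 1) :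
    qfiZ (prodWeight p) (fun b ω => f b (ω b)) ≤ 4 * Fintype.card β := by
  refine (qfiZ_prodWeight_le_sum_sq p hp0 hp f (fun _ => 1) hf).trans ?_
  simp

omit [DecidableEq β] in
/-- **Why purity matters (the variance only upper-bounds the QFI of a mixed state).** The classical
two-point mixture `W = ½δ_{↑…↑} + ½δ_{↓…↓}` — the Z-basis statistics of the SEPARABLE mixed state
`½(|0…0⟩⟨0…0| + |1…1⟩⟨1…1|)` — has `⟨Ẑ_bẐ_c⟩ = 1`, `⟨Ẑ_b⟩ = 0`, hence eq. (9) evaluates to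
`F = 4N²`, the Heisenberg ceiling: for mixed states `4(ΔJ)² ≥ F_Q` ("for all quantum states
`F_Q[ϱ,A] ≤ 4(ΔA)²` … the variance is concave"), so a value of eq. (9) above `4N` certifies
entanglement only for (close to) pure states. [cite: TothApellaniz2014, property (ii)
`F_Q[ϱ, A] ≤ 4(ΔA)²` and the concave-roof discussion (held text p0010–p0011)] -/
theorem qfiZ_twoPoint (N : ℕ) :
    qfiZ (fun ω : Fin N → Bool => if ω = (fun _ => true) then (1 / 2 : ℝ)
        else if ω = (fun _ => false) then 1 / 2 else 0)
      (fun b ω => if ω b then (1 : ℝ) else -1) = 4 * (N : ℝ) ^ 2 := by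
  rcases Nat.eq_zero_or_pos N with rfl | hN
  · simp [qfiZ]
  · have hne : (fun _ : Fin N => true) ≠ (fun _ => false) := by
      intro h
      have := congrFun h ⟨0, hN⟩
      simp at this
    have hE : ∀ g : (Fin N → Bool) → ℝ,
        expval (fun ω : Fin N → Bool => if ω = (fun _ => true) then (1 / 2 : ℝ)
          else if ω = (fun _ => false) then 1 / 2 else 0) g =
          1 / 2 * g (fun _ => true) + 1 / 2 * g (fun _ => false) := by
      intro g
      unfold expval
      rw [← Finset.sum_erase_add _ _ (Finset.mem_univ (fun _ : Fin N => true)),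
        ← Finset.sum_erase_add _ _ (Finset.mem_erase.mpr ⟨hne.symm, Finset.mem_univ _⟩)]
      rw [Finset.sum_eq_zero fun ω hω => ?_]
      · simp [hne.symm]
        ring
      · have h1 : ω ≠ fun _ => false := Finset.ne_of_mem_erase hω
        have h2 : ω ≠ fun _ => true := Finset.ne_of_mem_erase (Finset.mem_of_mem_erase hω)
        simp [h1, h2]
    unfold qfiZ
    simp_rw [hE]
    simp
    ring

omit [DecidableEq β] [∀ b, Fintype (Ω b)] in
/-- **Born weights of product states are product weights**: for `ψ(ω) = ∏_b φ_b(ω_b)`,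
`|ψ(ω)|² = ∏_b |φ_b(ω_b)|²`, so the Z-basis statistics of a pure `k`-producible state
`⊗_b |φ_b⟩` are a `prodWeight` and the bounds above apply to its eq.-(9) value.
[cite: TothApellaniz2014, §3.2 (pure `k`-producible states `⊗_l |Ψ_l⟩`, held text p0008)] -/
theorem normSq_prod_eq_prodWeight (φ : ∀ b, Ω b → ℂ) (ω : ∀ b, Ω b) :
    Complex.normSq (∏ b, φ b (ω b)) = prodWeight (fun b x => Complex.normSq (φ b x)) ω := by
  rw [prodWeight, map_prod Complex.normSq]

omit [Fintype β] [DecidableEq β] in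
/-- **Diagonal observables are read off the Born weights**: for a computational-basis-diagonal
observable `D = diag(d)` (any product of `Ẑ`'s) and a vector `ψ`,
`⟨ψ|D|ψ⟩ = Σ_ω |ψ(ω)|² d(ω) = ⟨d⟩_{|ψ|²}` — the sense in which eq. (9) "can be readily
reconstructed from measured bitstring samples". [cite: NagaoEtAl2026, eq. (9) and the sentence
after it ("reconstructed from measured bitstring samples obtained in shots")] -/
theorem star_dotProduct_diagonal_mulVec {Ω' : Type*} [Fintype Ω'] [DecidableEq Ω'] (ψ : Ω' → ℂ)
    (d : Ω' → ℝ) :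
    star ψ ⬝ᵥ (Matrix.diagonal (fun ω => (d ω : ℂ)) *ᵥ ψ) =
      ((expval (fun ω => Complex.normSq (ψ ω)) d : ℝ) : ℂ) := by
  rw [dotProduct, expval]
  push_cast
  refine Finset.sum_congr rfl fun ω _ => ?_
  rw [Matrix.mulVec_diagonal, Pi.star_apply, Complex.star_def, Complex.normSq_eq_conj_mul_self]
  ring

end Spins

/-! ### The "Haar random value": the mean of `4(⟨A²⟩ − ⟨A⟩²)` over a state 2-design -/

section Design

open Literature.Computability.QuantumComplexity.DesignAnticoncentration TwoCopy

variable {V : Type*} [Fintype V] [DecidableEq V] {J : Type*} [Fintype J]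

omit [DecidableEq V] in
/-- `Tr(|ψ⟩⟨ψ| A) = ⟨ψ|A|ψ⟩`. [folklore] -/
private theorem trace_proj_mul (ψ : V → ℂ) (A : Matrix V V ℂ) :
    (proj ψ * A).trace = star ψ ⬝ᵥ (A *ᵥ ψ) := by
  rw [← Matrix.trace_mul_comm, proj, Matrix.mul_vecMulVec, Matrix.trace_vecMulVec, dotProduct_comm]

omit [DecidableEq V] in
/-- `Tr |ψ⟩⟨ψ| = Σ |ψ_a|²` (`= 1` for the unit vectors of a design). [folklore] -/
private theorem trace_proj (ψ : V → ℂ) : (proj ψ).trace = ((∑ a, Complex.normSq (ψ a) : ℝ) : ℂ) := by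
  rw [proj, Matrix.trace_vecMulVec, dotProduct]
  push_cast
  exact Finset.sum_congr rfl fun a _ => by rw [Pi.star_apply, Complex.star_def, Complex.mul_conj]

/-- **Second moment of expectation values over a state 2-design** (hence over Haar-random states):
`(1/K) Σ_j ⟨ψ_j|A|ψ_j⟩⟨ψ_j|B|ψ_j⟩ = (Tr A · Tr B + Tr(AB)) / (N(N+1))` — the design identity
`(1/K) Σ_j (|ψ_j⟩⟨ψ_j|)^{⊗2} = (𝟙 + F)/(N(N+1))` multiplied by `A ⊗ B` and traced, with the swap
trick `Tr(F(A ⊗ B)) = Tr(AB)`. [cite: ZhuEtAl2016, §2 Proposition 1 at `t = 2` (the design identity;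
this is its trace against `A ⊗ B`)] [cite: EkertEtAl2002, eq. (2) (`Tr V(A⊗B) = Tr AB`)] -/
theorem twoDesign_avg_expect_mul_expect {ψ : J → V → ℂ} (h : IsStateTwoDesign ψ)
    (A B : Matrix V V ℂ) :
    ((Fintype.card J : ℂ))⁻¹ * ∑ j, (proj (ψ j) * A).trace * (proj (ψ j) * B).trace =
      (((Fintype.card V : ℂ)) * (Fintype.card V + 1))⁻¹ *
        (A.trace * B.trace + (A * B).trace) := by
  have hx := congrArg (fun M => (M * (A ⊗ₖ B)).trace) h.tensor_two
  simp only [Matrix.smul_mul, Matrix.trace_smul, Finset.sum_mul, Matrix.trace_sum, smul_eq_mul,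
    add_mul, one_mul, Matrix.trace_add] at hx
  simp_rw [← Matrix.mul_kronecker_mul, Matrix.trace_kronecker] at hx
  rw [trace_swapOp_mul_kronecker] at hx
  exact hx

/-- **First moment** (the `t = 1` identity, obtained from `t = 2` with `B = 𝟙`):
`(1/K) Σ_j ⟨ψ_j|A|ψ_j⟩ = Tr A / N`. [cite: ZhuEtAl2016, §2 Proposition 1 (a 2-design is a
1-design: `(1/K)Σ_j |ψ_j⟩⟨ψ_j| = 𝟙/N`)] -/
theorem twoDesign_avg_expect [Nonempty V] {ψ : J → V → ℂ} (h : IsStateTwoDesign ψ)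
    (A : Matrix V V ℂ) :
    ((Fintype.card J : ℂ))⁻¹ * ∑ j, (proj (ψ j) * A).trace = ((Fintype.card V : ℂ))⁻¹ * A.trace := by
  have hx := twoDesign_avg_expect_mul_expect h A 1
  have h1 : ∀ j, (proj (ψ j)).trace = 1 := fun j => by
    rw [trace_proj, h.norm_sq j, Complex.ofReal_one]
  simp only [Matrix.trace_one, h1, mul_one] at hx
  rw [hx]
  have hN : (Fintype.card V : ℂ) ≠ 0 := Nat.cast_ne_zero.mpr Fintype.card_ne_zero
  have hN1 : (Fintype.card V : ℂ) + 1 ≠ 0 := by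
    rw [← Nat.cast_succ]; exact Nat.cast_ne_zero.mpr (Nat.succ_ne_zero _)
  field_simp

/-- **The design (Haar) mean of the pure-state QFI.** For every observable `A`, the average over a
state 2-design of `4(⟨ψ|A²|ψ⟩ − ⟨ψ|A|ψ⟩²)` — eq. (9) evaluated in a typical ("Haar random",
infinite-temperature) pure state — equals `4 [Tr A²/N − (Tr A² + (Tr A)²)/(N(N+1))]`.
[cite: NagaoEtAl2026, Fig. 4 and text ("the QFI rapidly approaches the Haar random value
F_Q^Haar … signaling thermalization to an infinite-temperature state described by Haar-random
states")] [cite: ZhuEtAl2016, §2 Proposition 1 (t = 2)] -/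
theorem twoDesign_avg_qfi [Nonempty V] {ψ : J → V → ℂ} (h : IsStateTwoDesign ψ)
    (A : Matrix V V ℂ) :
    ((Fintype.card J : ℂ))⁻¹ * ∑ j, 4 * ((proj (ψ j) * (A * A)).trace - (proj (ψ j) * A).trace ^ 2) =
      4 * (((Fintype.card V : ℂ))⁻¹ * (A * A).trace -
        (((Fintype.card V : ℂ)) * (Fintype.card V + 1))⁻¹ * (A.trace * A.trace + (A * A).trace)) := by
  have h2 := twoDesign_avg_expect_mul_expect h A A
  have h1 := twoDesign_avg_expect h (A * A)
  rw [← h1, ← h2]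
  have h3 : ∀ j, 4 * ((proj (ψ j) * (A * A)).trace - (proj (ψ j) * A).trace ^ 2) =
      4 * (proj (ψ j) * (A * A)).trace - 4 * ((proj (ψ j) * A).trace * (proj (ψ j) * A).trace) :=
    fun j => by ring
  simp_rw [h3]
  rw [Finset.sum_sub_distrib, ← Finset.mul_sum, ← Finset.mul_sum]
  ring

/-- **Traceless observables with `Tr A² = cN`**: the design mean of `4(⟨A²⟩ − ⟨A⟩²)` is
`4cN/(N+1) < 4c`. For the collective spin `A = Σ_{i=1}^n Ẑ_i` on `n` qubits (`N = 2ⁿ`, `Tr A = 0`,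
`Tr A² = n·2ⁿ`, see `trace_collectiveZ`, `trace_collectiveZ_sq`) this is the "Haar random value"
`F_Q^Haar = 4n·2ⁿ/(2ⁿ+1)` of eq. (9) — strictly BELOW the separable bound `4n` of
`qfiZ_prodWeight_le_four_mul_card`. [cite: NagaoEtAl2026, Fig. 4 caption (`F_Q^Haar`)]
[cite: ZhuEtAl2016, §2 Proposition 1 (t = 2)] -/
theorem twoDesign_avg_qfi_of_trace_zero [Nonempty V] {ψ : J → V → ℂ}
    (h : IsStateTwoDesign ψ) (A : Matrix V V ℂ) (hA : A.trace = 0) {c : ℂ}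
    (hA2 : (A * A).trace = c * Fintype.card V) :
    ((Fintype.card J : ℂ))⁻¹ * ∑ j, 4 * ((proj (ψ j) * (A * A)).trace - (proj (ψ j) * A).trace ^ 2) =
      4 * c * (Fintype.card V : ℂ) / (Fintype.card V + 1) := by
  rw [twoDesign_avg_qfi h A, hA, hA2, mul_zero, zero_add]
  have hN : (Fintype.card V : ℂ) ≠ 0 := Nat.cast_ne_zero.mpr Fintype.card_ne_zero
  have hN1 : (Fintype.card V : ℂ) + 1 ≠ 0 := by
    rw [← Nat.cast_succ]; exact Nat.cast_ne_zero.mpr (Nat.succ_ne_zero _)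
  field_simp
  ring

end Design

/-! ### The collective spin `Σ_i Ẑ_i` on `n` qubits: `Tr = 0`, `Tr(·)² = n·2ⁿ` -/

section CollectiveZ

variable {κ : Type*} [Fintype κ] [DecidableEq κ]

/-- The eigenvalue `±1` of `Ẑ_i` on the bit string `s` (`|0⟩ ↦ +1`, `|1⟩ ↦ −1`). [folklore] -/
def zVal (i : κ) (s : κ → Bool) : ℝ := if s i then -1 else 1

/-- The collective spin `Σ_i Ẑ_i` as a diagonal matrix in the computational basis (`= 2J_z`).
[cite: TothApellaniz2014, eq. `J_l := Σ_n j_l^{(n)}` (held text p0004)] -/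
def collectiveZ (κ : Type*) [Fintype κ] [DecidableEq κ] : Matrix (κ → Bool) (κ → Bool) ℂ :=
  Matrix.diagonal fun s => ((∑ i, zVal i s : ℝ) : ℂ)

/-- Flipping bit `i` (an involution of the bit strings). [folklore] -/
def flipAt (i : κ) (s : κ → Bool) : κ → Bool := Function.update s i (!s i)

omit [Fintype κ] in
/-- `flipAt i` is an involution. [folklore] -/
private theorem flipAt_flipAt (i : κ) (s : κ → Bool) : flipAt i (flipAt i s) = s := by
  funext j
  unfold flipAt
  by_cases hj : j = i
  · subst hj; simp
  · simp [Function.update_of_ne hj]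

omit [Fintype κ] in
/-- Flipping bit `i` reverses the sign of `Ẑ_i`. [folklore] -/
private theorem zVal_flipAt_self (i : κ) (s : κ → Bool) : zVal i (flipAt i s) = -zVal i s := by
  unfold zVal flipAt
  rw [Function.update_self]
  cases s i <;> simp

omit [Fintype κ] in
/-- Flipping bit `i` leaves `Ẑ_j`, `j ≠ i`, unchanged. [folklore] -/
private theorem zVal_flipAt_of_ne {i j : κ} (hij : j ≠ i) (s : κ → Bool) :
    zVal j (flipAt i s) = zVal j s := by
  unfold zVal flipAt
  rw [Function.update_of_ne hij]

/-- `Σ_s g(s) = 0` whenever `g` is odd under flipping bit `i`. [folklore] -/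
private theorem sum_eq_zero_of_flip_odd (i : κ) (g : (κ → Bool) → ℝ)
    (hg : ∀ s, g (flipAt i s) = -g s) : ∑ s, g s = 0 := by
  have hinv : Function.Involutive (flipAt i) := flipAt_flipAt i
  have h := Fintype.sum_equiv hinv.toPerm g (fun s => -g s) (fun s => by
    rw [Function.Involutive.coe_toPerm, hg, neg_neg])
  rw [Finset.sum_neg_distrib] at h
  linarith

/-- `Tr Σ_i Ẑ_i = 0`. [cite: TothApellaniz2014, §2 (the collective angular momentum `J_z`,
traceless), held text p0004] -/
theorem trace_collectiveZ : (collectiveZ κ).trace = 0 := by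
  rw [collectiveZ, Matrix.trace_diagonal]
  rw [← Complex.ofReal_zero, show (0 : ℝ) = ∑ s : κ → Bool, ∑ i, zVal i s by
    rw [Finset.sum_comm]
    exact (Finset.sum_eq_zero fun i _ => sum_eq_zero_of_flip_odd i _ (zVal_flipAt_self i)).symm]
  push_cast
  rfl

/-- `Tr (Σ_i Ẑ_i)² = n · 2ⁿ` (`Tr ẐᵢẐⱼ = 2ⁿ δᵢⱼ`). [cite: TothApellaniz2014, §2 (collective angular
momentum components), held text p0004] -/
theorem trace_collectiveZ_sq :
    (collectiveZ κ * collectiveZ κ).trace = (Fintype.card κ : ℂ) * Fintype.card (κ → Bool) := by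
  rw [collectiveZ, Matrix.diagonal_mul_diagonal, Matrix.trace_diagonal]
  have key : ∀ s : κ → Bool, (∑ i, zVal i s) * (∑ i, zVal i s) =
      ∑ i, ∑ j, zVal i s * zVal j s := fun s => Finset.sum_mul_sum _ _ _ _
  have hdiag : ∀ i : κ, ∀ s : κ → Bool, zVal i s * zVal i s = 1 := fun i s => by
    unfold zVal; split <;> norm_num
  have hoff : ∀ i j : κ, i ≠ j → ∑ s : κ → Bool, zVal i s * zVal j s = 0 := fun i j hij =>
    sum_eq_zero_of_flip_odd i _ fun s => by
      rw [zVal_flipAt_self, zVal_flipAt_of_ne (Ne.symm hij)]; ring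
  have hsum : ∑ s : κ → Bool, (∑ i, zVal i s) * (∑ i, zVal i s) =
      (Fintype.card κ : ℝ) * Fintype.card (κ → Bool) := by
    simp_rw [key]
    rw [Finset.sum_comm]
    have : ∀ i : κ, ∑ s : κ → Bool, ∑ j, zVal i s * zVal j s = Fintype.card (κ → Bool) := by
      intro i
      rw [Finset.sum_comm, ← Finset.sum_erase_add _ _ (Finset.mem_univ i),
        Finset.sum_eq_zero fun j hj => hoff i j (Finset.ne_of_mem_erase hj).symm, zero_add]
      simp [hdiag]
    simp_rw [this]
    simp
  have := congrArg (fun r : ℝ => (r : ℂ)) hsum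
  push_cast at this ⊢
  exact this

end CollectiveZ

/-! ### The Haar (2-design) value of eq. (9) and its position below the separable bound -/

section HaarValue

open Literature.Computability.QuantumComplexity.DesignAnticoncentration

variable {κ : Type*} [Fintype κ] [DecidableEq κ] {J : Type*} [Fintype J]

/-- **`F_Q^Haar` for `n` qubits.** Over any state 2-design `{ψ_j}` on `n = |κ|` qubits (a proxy for
Haar-random pure states, which form the limiting 2-design), the mean of eq. (9) evaluated in the pure
state `ψ_j` — `4(⟨ψ_j|J²|ψ_j⟩ − ⟨ψ_j|J|ψ_j⟩²)`, `J = Σ_i Ẑ_i` — is `4n·2ⁿ/(2ⁿ + 1)`.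
[cite: NagaoEtAl2026, Fig. 4 and text ("the QFI rapidly approaches the Haar random value F_Q^Haar
… thermalization to an infinite-temperature state described by Haar-random states")]
[cite: ZhuEtAl2016, §2 Proposition 1 (t = 2)] -/
theorem twoDesign_avg_qfi_collectiveZ {ψ : J → (κ → Bool) → ℂ} (h : IsStateTwoDesign ψ) :
    ((Fintype.card J : ℂ))⁻¹ * ∑ j, 4 * ((proj (ψ j) * (collectiveZ κ * collectiveZ κ)).trace -
        (proj (ψ j) * collectiveZ κ).trace ^ 2) =
      4 * (Fintype.card κ : ℂ) * (Fintype.card (κ → Bool) : ℂ) / (Fintype.card (κ → Bool) + 1) :=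
  twoDesign_avg_qfi_of_trace_zero h (collectiveZ κ) trace_collectiveZ trace_collectiveZ_sq

omit [Fintype J] in
/-- … and this Haar value lies strictly BELOW the separable bound `4n` of
`qfiZ_prodWeight_le_four_mul_card` (for `n ≥ 1`): `4n·2ⁿ/(2ⁿ+1) < 4n`. So a measured eq.-(9) value
that "approaches the Haar random value" from below never crosses the threshold above which eq. (9)
(in a pure state) would witness entanglement. [cite: TothApellaniz2014, eq. `F_Q[ϱ, J_l] ≤ N` for
separable states (held text p0014)] [cite: NagaoEtAl2026, Fig. 4 caption (`F_Q^Haar`)] -/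
theorem haarValue_lt_separable_bound [Nonempty κ] :
    4 * (Fintype.card κ : ℝ) * (Fintype.card (κ → Bool) : ℝ) / (Fintype.card (κ → Bool) + 1) <
      4 * (Fintype.card κ : ℝ) := by
  have hn : 0 < (Fintype.card κ : ℝ) := Nat.cast_pos.mpr Fintype.card_pos
  have hN : 0 < (Fintype.card (κ → Bool) : ℝ) := Nat.cast_pos.mpr Fintype.card_pos
  rw [div_lt_iff₀ (by linarith)]
  nlinarith

end HaarValue

/-! ### The `k`-producible bound `F ≤ 4(sk² + (N − sk)²)` (appended, harvest-2 gen 43) -/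

section KProducible

/-- **The block-size maximisation** behind the `k`-producible bound: for natural block sizes
`N_b ≤ k` with `Σ_b N_b = sk + r`, `r < k`, one has `Σ_b N_b² ≤ sk² + r²` (move spins between
unsaturated blocks; induction on the set of blocks). [cite: TothApellaniz2014, §5.2
eq. `F_Q[ϱ,J_l] ≤ sk² + (N−sk)²`, “where `s` is the integer part of `N/k`” (held text p0015)] -/
theorem sum_sq_le_of_blocks_le {β : Type*} [DecidableEq β] (S : Finset β) (Nb : β → ℕ) (k : ℕ)
    (hNb : ∀ b ∈ S, Nb b ≤ k) :
    ∀ s r : ℕ, ∑ b ∈ S, Nb b = s * k + r → r < k →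
      ∑ b ∈ S, ((Nb b : ℝ)) ^ 2 ≤ s * (k : ℝ) ^ 2 + (r : ℝ) ^ 2 := by
  induction S using Finset.induction_on with
  | empty =>
    intro s r _ _
    simp only [Finset.sum_empty]
    positivity
  | @insert a S ha ih =>
    intro s r hsum hr
    have hNbS : ∀ b ∈ S, Nb b ≤ k := fun b hb => hNb b (Finset.mem_insert_of_mem hb)
    have hm : Nb a ≤ k := hNb a (Finset.mem_insert_self a S)
    rw [Finset.sum_insert ha] at hsum ⊢
    set m := Nb a with hmdef
    set M := ∑ b ∈ S, Nb b with hMdef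
    by_cases hcase : m ≤ r
    · -- same number of full blocks, remainder `r − m`
      have hM : M = s * k + (r - m) := by omega
      have h := ih hNbS s (r - m) hM (by omega)
      have hcast : ((r - m : ℕ) : ℝ) = (r : ℝ) - m := by rw [Nat.cast_sub hcase]
      rw [hcast] at h
      have hm0 : (0 : ℝ) ≤ m := Nat.cast_nonneg m
      have hmr : (m : ℝ) ≤ r := by exact_mod_cast hcase
      nlinarith [h, hm0, hmr]
    · -- one full block fewer, remainder `r + k − m`
      push Not at hcase
      have hs : 1 ≤ s := by
        by_contra h0
        push Not at h0
        have : s = 0 := by omega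
        subst this
        omega
      obtain ⟨s₀, rfl⟩ : ∃ s₀, s = s₀ + 1 := ⟨s - 1, by omega⟩
      have hM : M = s₀ * k + (r + k - m) := by
        have e : m + M = (s₀ + 1) * k + r := hsum
        have e' : (s₀ + 1) * k = s₀ * k + k := by ring
        rw [e'] at e
        generalize s₀ * k = T at e ⊢
        omega
      have h := ih hNbS s₀ (r + k - m) hM (by omega)
      have hcast : ((r + k - m : ℕ) : ℝ) = (r : ℝ) + k - m := by
        rw [Nat.cast_sub (by omega)]; push_cast; ring
      rw [hcast] at h
      have hmr : (r : ℝ) ≤ m := by exact_mod_cast hcase.le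
      have hmk : (m : ℝ) ≤ k := by exact_mod_cast hm
      have hprod : 0 ≤ ((m : ℝ) - r) * ((k : ℝ) - m) := mul_nonneg (by linarith) (by linarith)
      push_cast
      nlinarith [h, hprod]

variable {β : Type*} [Fintype β] [DecidableEq β] {Ω : β → Type*} [∀ b, Fintype (Ω b)]

/-- **The `k`-producible bound** (Hyllus et al. 2012, Tóth 2012) in the normalisation of eq. (9):
for a product weight over blocks of sizes `N_b ≤ k` (so the pure state is `k`-producible) and
block observables bounded by the block size (`|Z_b| ≤ N_b`, e.g. `Z_b = Σ_{i∈b} Ẑ_i`), with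
`N = Σ_b N_b = sk + r`, `r < k`: `F ≤ 4(sk² + r²)`, i.e. the review's `F_Q ≤ sk² + (N − sk)²`.
[cite: TothApellaniz2014, §5.2 eq. `F_Q[ϱ,J_l] ≤ sk² + (N−sk)²` for `N`-qubit `k`-producible
states, `s` the integer part of `N/k` (held text p0015)] -/
theorem qfiZ_prodWeight_le_kProducible (p : ∀ b, Ω b → ℝ) (hp0 : ∀ b x, 0 ≤ p b x)
    (hp : ∀ b, ∑ x, p b x = 1) (f : ∀ b, Ω b → ℝ) (Nb : β → ℕ)
    (hf : ∀ b x, |f b x| ≤ Nb b) {k s r : ℕ} (hk : ∀ b, Nb b ≤ k)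
    (hN : ∑ b, Nb b = s * k + r) (hr : r < k) :
    qfiZ (prodWeight p) (fun b ω => f b (ω b)) ≤ 4 * (s * (k : ℝ) ^ 2 + (r : ℝ) ^ 2) := by
  refine (qfiZ_prodWeight_le_sum_sq p hp0 hp f (fun b => (Nb b : ℝ)) hf).trans ?_
  refine mul_le_mul_of_nonneg_left ?_ (by norm_num)
  exact sum_sq_le_of_blocks_le Finset.univ Nb k (fun b _ => hk b) s r hN hr

/-- The same with `s = N / k`, `r = N % k` (“`s` is the integer part of `N/k`”, `k ≥ 1`).
[cite: TothApellaniz2014, §5.2 eq. `F_Q[ϱ,J_l] ≤ sk² + (N−sk)²` (held text p0015)] -/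
theorem qfiZ_prodWeight_le_kProducible_div (p : ∀ b, Ω b → ℝ) (hp0 : ∀ b x, 0 ≤ p b x)
    (hp : ∀ b, ∑ x, p b x = 1) (f : ∀ b, Ω b → ℝ) (Nb : β → ℕ)
    (hf : ∀ b x, |f b x| ≤ Nb b) {k : ℕ} (hk0 : 0 < k) (hk : ∀ b, Nb b ≤ k) :
    qfiZ (prodWeight p) (fun b ω => f b (ω b)) ≤
      4 * (((∑ b, Nb b) / k : ℕ) * (k : ℝ) ^ 2 + (((∑ b, Nb b) % k : ℕ) : ℝ) ^ 2) :=
  qfiZ_prodWeight_le_kProducible p hp0 hp f Nb hf hk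
    (by rw [mul_comm]; exact (Nat.div_add_mod _ k).symm) (Nat.mod_lt _ hk0)

end KProducible

end CollectiveVariance

end Literature.InformationTheory.Entanglement
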